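/-
Copyright (c) 2026 the pub-hodgecm-mathlib formalisation cell (harness21).  Prover seat hodgecm-mathlib-K2Liu-p01 (g11), Track B «K2-LIT» ∕ hLiu418 #184♮, socket #41,
KIND 1 a♮ — (K1a-OF-RECORD) THE K1-a♮ BLOCK OF RECORD AT `n = 2` (LEAD F0P6-plan (g15) BATCH #213 (1); K1a desk K2E5-p16 (g8)): ★ p863404 §2 RUN ON THE RECORD
CARRIER WITH EVERY ★-PAID PLACE LETTER DISCHARGED BY NAME.  The K1-a♮ twin of ★ p863630 `K2LiuKindOneLineTermOfRecord`.  THEOREMS ONLY (no `def`, no `instance`, no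
notation, no named-fact hypothesis, no `sorry`).
-/
import Summits.HodgeConjecture.HodgeConjecture.Theorems.K2LiuKindOneSingularTermPackage        -- ★ p863404 §2 `exists_kindOne_singularTermPackage_of_placeLetters` (K2E4-p10)
import Summits.HodgeConjecture.HodgeConjecture.Theorems.K2LiuKindOneSingularTailOfRecord        -- ★ p863805 (K1a-T) `htail_hsplit_of_record` (K2Liu-p03)
import Summits.HodgeConjecture.HodgeConjecture.Theorems.K2LiuKindWFactorizableDecomposition     -- ★ (KW-fac) `exists_kindW_factorization` (K2E3-p26)
import Summits.HodgeConjecture.HodgeConjecture.Theorems.K2LiuKindWCarrierOfRecord              -- ★ (KW-car) `exists_kindW_carrierLetters_haar` (K2E4-p11)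
import Summits.HodgeConjecture.HodgeConjecture.Theorems.K2LiuKindOneArchLetterIntegrable        -- ★ `hintArch_of_isArchSiegelSection` (K2Liu-p03)
import Summits.HodgeConjecture.HodgeConjecture.Theorems.K2LiuKindWFiniteLetterIntegrable        -- ★ (iii-fin-int) `integrable_conj_unipDeltaChar_mul_of_isLocalSiegelSection` (F0P2-p08)
import Summits.HodgeConjecture.HodgeConjecture.Theorems.K2LiuKindOneSingularScalarGL1           -- ★ p862613 `exists_differentiableOn_sub_half_mul_scalarK1_cm` (LH4-p07)
import Summits.HodgeConjecture.HodgeConjecture.Theorems.K2LiuKindOneSingularDecayOfLetters      -- ★ p863488 (K1a-dec) `hdec_of_factorBounds` (K2E4-p10)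
import Summits.HodgeConjecture.HodgeConjecture.Theorems.K2LiuKindOneSingularScalarBound         -- ★ p864035 (K1a-dec-L4) `hGb_of_countLetter` (K2E4-p10)
import Summits.HodgeConjecture.HodgeConjecture.Theorems.K2LiuKindOneSingularSupportOfLetters    -- ★ p863740 (K1a-supp½) `hsupp_of_termPlaceSupport` (K2E5-p17)
import Summits.HodgeConjecture.HodgeConjecture.Theorems.K2LiuConjugateSymplecticInv             -- ★ `IsConjugateSymplectic.inv`
import Literature.NumberTheory.Automorphic.IdeleClassCharacterHecke                               -- ★ `isUnitary_toHeckeCharacter`, `hasUnitaryArchType_toHeckeCharacter_iff`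
import HarnessLib

/-!
# Crux `HLiu418`, socket #41, KIND 1 a♮ — (K1a-OF-RECORD) `K2LiuKindOneSingularTermOfRecord`: THE K1-a♮ BLOCK OF RECORD AT `n = 2`

Cell `hodgecm-mathlib`, crux item hLiu418 = `stmt-HodgeConjecture-24832` (helper lane `--supports … --as helper`, count-neutral), route of record
`HCCMUnconditional`; squad K2 ∕ K2Liu, road `K2_Liu`, socket #41 `sig_K2LiuSiegelEisensteinContinuation`, KIND 1, block K1-a♮ = the by-value letters
`(Eac hEad hEac τa hτa Na hdeca {Ca κa} hCa hκa hsuppa)` of ★ ED. 20 :133–:147 — the continued `(s − ½)·`normalised singular (rank-one) Whittaker term.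

THE MATHEMATICS [KudlaRallis1994, §2 (2.10)–(2.12)], [Tan1999, §3, §4 Prop. 4.8], [KudlaSweet1997, §1], [MoeglinWaldspurger1995, II.1.7, IV.1.9], [Shimura1997, §18.4].
★ p863404 §2 `exists_kindOne_singularTermPackage_of_placeLetters` produces the twelve K1-a♮ letters (plus the (F-V) witness equations) from 34 by-value PLACE LETTERS.
THIS FILE runs it ON THE RECORD: the Whittaker–Euler factorisation of the standard family (★ (KW-fac) `exists_kindW_factorization`: bad set `S₀`, pure tensors
`Finf_j(s) = H_𝒦^{2(s−s₀)}·A_j`, local factors `Fv_{j,v}(s) = H^{2(s−s₀)}·b_{j,v}` on `S₀`, `Λ_{s,v}` off `S₀`), the Haar carriers of record (★ `exists_kindW_carrierLetters_haar`),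
the two integrability letters of ★ p863805 BY NAME (`hintArch` ★ `hintArch_of_isArchSiegelSection`; `hintLoc` §1 here, from ★ (iii-fin-int) at the (KW-fac) reading), the
singular tail of record ★ p863805 `htail_hsplit_of_record` (corner transport, raw archimedean ∕ local factors `A W`, local index sets `T`, moving exceptional set `Pm`, shells
`D` with exponents `mτ`, the tail identity on `{1 < re s}`), the pole-cleared K1 scalar ★ p862613, and the two bookkeeping producers ★ p863488 `hdec_of_factorBounds` (with
(L0) the constant `c = (∫β)⁻¹` and (L1) the tensor count `#univ = m` DISCHARGED HERE, (L4) ★ p864035 `hGb_of_countLetter`) and ★ p863740 `hsupp_of_termPlaceSupport`.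
* §1 **`hintLoc_of_reading`** — ★ p863805's local integrability binder `hintLoc` PAID for the (KW-fac) reading of the local factors (any index, any point, every place):
  above `S₀` the flat twist `H^{2(s−s₀)}·b_{j,v} ∈ I_v(s,χ_v)` (★ (KW-fac)'s `hb`), off `S₀` the unramified section `Λ_{s,v}` (★ `lambdaLoc_mem_localDegPS`), both smooth local
  Siegel sections, so ★ (iii-fin-int) `integrable_conj_unipDeltaChar_mul_of_isLocalSiegelSection` applies (`χ` unitary).
* §2 **`exists_kindOne_singularTerm_of_record`** — THE HEAD.  Socket prefix at `n = 2` VERBATIM (as ★ p863630, minus `wq hwq`); then BY VALUE, in the currency the tie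
  `obtain`s BY NAME: (i) the bad set `T₀` (= the (KW-fac) `S₀`) and the pole-cleared scalar `G hG hsc` at `↑T₀` (★ p862613 — kept by value so that BLOCK D reads the SAME `G`
  off the witness equation); (ii) ★ p863805's outputs `T D Pm mτ A W` with the four spec letters §2 of ★ p863404 reads (`hPT hq hP htail`, bytes of ★ p863805 (c)(d)(e) at
  `c₀ := (∫β)⁻¹`); (iii) THE LETTERS STILL IN FLIGHT, each with its named payer: «ARCH-CONT» `Ac hAc hA` ((Φ-S1) R90-C131-p02: ★ p863574 ∕ ★ p863873 ∕ ★ p863874 scalar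
  `K_w`-type, non-scalar types (iii-b-3)); «LOC-FACE» `Gn hGn hW` (LH4-p07 over ★ `exists_localFace_kindOneSingular`); the size `τa hτa`; (L2) `hAcb` (C131-p02
  `hAcb_of_corner`); (L3) `hGnb` (localFace ∕ ★ p863455); (L4)'s count letter `Np hCp hap hPm` (LH7-p05 `pow_card_Pm_le_height`); (L5) `hPb` ((K1a-T) `D∕mτ` divisor count);
  «LATTICE» `Tδ δ hδ k hterm` (K2Liu-p14 (K1a-supp) ED. 2).  CONCLUSION = ★ p863404 §2's conclusion VERBATIM at `n = 2`, `c S h := (∫β)⁻¹`, `I S h := univ`,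
  `HT := Σ_j A·∏W`, `P S h v s := Σ_{k≤mτ S v}(ε_v q_v^{1−2s})^k`, `T'' := ↑T₀`: the two WITNESS equations and the twelve K1-a♮ letters of ★ ED. 20 :133–:147.
  Proof: ★ §2 at those letters, `hdec := ★ hdec_of_factorBounds` ((L0) `‖(∫β)⁻¹‖·H^0·(1+τ)^0`, (L1) `#univ ≤ m`, (L4) ★ `hGb_of_countLetter hG`), `hsupp := ★ hsupp_of_termPlaceSupport`.
WHY THE (K1a-T) OUTPUTS ARE BY VALUE AND NOT RE-DERIVED INSIDE (census `CENSUS-K1a-OF-RECORD.K2Liu-p01-g11.md`, finding): ★ p863805's witnesses `σc gc` — hence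
`T D Pm mτ A W` — are existential; every growth ∕ support letter of (iii) speaks about them, so they must be the tie's `obtain`ed NAMES (0 `sorry`: ★ p863805 with §1 and
★ `hintArch_of_isArchSiegelSection`), shared by this head and by the letters' payers.
HONEST LABEL.  Count-neutral helper, hypothesis-first in the in-flight letters; it closes no socket by itself: `HC_CM` is proved only modulo the 7 printed citations
(2 remaining named inputs: hLiu418 = `stmt-HodgeConjecture-24832`, h413 = `stmt-HodgeConjecture-24833`) until rung 0 closes.

## References
* [KudlaRallis1994] S. Kudla, S. Rallis, *A regularized Siegel–Weil formula: the first term identity*, Ann. of Math. 140 (1994): §2 (2.10)–(2.12).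
* [Tan1999] V. Tan, *Poles of Siegel Eisenstein series on U(n,n)*, Canad. J. Math. 51 (1999): §3, §4 Prop. 4.8.
* [KudlaSweet1997] S. Kudla, W. J. Sweet, Israel J. Math. 98 (1997): §1.   * [MoeglinWaldspurger1995] C. Mœglin, J.-L. Waldspurger (1995): II.1.7, IV.1.9.
* [Shimura1997] G. Shimura, CBMS 93 (1997): §18.4 Prop. 18.14.   * [HarrisKudlaSweet1996] M. Harris, S. Kudla, W. J. Sweet, J. AMS 9 (1996): §1 (1.15).
-/

set_option autoImplicit false
-- the mandated namespace repeats the single-problem summit's segment (`HodgeConjecture.HodgeConjecture`)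
set_option linter.dupNamespace false

noncomputable section

open scoped Matrix ENNReal NNReal Topology ComplexConjugate RestrictedProduct
open NumberField IsDedekindDomain MeasureTheory MeasureTheory.Measure Filter Set Function Metric
open Literature.NumberTheory.Automorphic Literature.NumberTheory.Automorphic.UnitaryGroup Literature.NumberTheory.GaloisRepresentations
open Literature.NumberTheory.LFunctions
open Literature.NumberTheory.GelbartRogawski1991 Literature.NumberTheory.GelbartRogawski1991.GRConstruction
open Literature.NumberTheory.GelbartRogawski1991.UnitaryDualPair
open Literature.NumberTheory.K2Lit.SiegelDoubled Literature.NumberTheory.K2Lit.LocalSiegelDoubled Literature.NumberTheory.K2Lit.PlaceSplitting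
open Literature.MeasureTheory.Group Literature.MeasureTheory.RestrictedProduct
open Literature.Topology.Algebra.RestrictedProduct (inH)
open Literature.NumberTheory.Automorphic.IdeleClassGroup

namespace Summit.HodgeConjecture.HodgeConjecture.Cruxes.HLiu418.K2LiuKindOneSingularTermOfRecord

open K2LiuSiegelUnipotentFourierDefs K2LiuSiegelUnipotentCharacters K2LiuUnipotentCoveringWeight K2LiuSiegelFourierCoeffDelta
open K2LiuSiegelUnipotentLocalDefs K2LiuSiegelUnipotentSplitDefs K2LiuSiegelUnipotentSplitAtDefs K2LiuSiegelEisensteinKindWLetters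
open K2LiuQRationalDefs (IsQRationalRegularAt)
open K2LiuKindOneSingularTermPackage (exists_kindOne_singularTermPackage_of_placeLetters)
open K2LiuKindWFiniteLetterIntegrable (integrable_conj_unipDeltaChar_mul_of_isLocalSiegelSection)
open K2LiuKindOneSingularDecayOfLetters (hdec_of_factorBounds)
open K2LiuKindOneSingularScalarBound (hGb_of_countLetter)
open K2LiuKindOneSingularSupportOfLetters (hsupp_of_termPlaceSupport)

variable (L : Type) [Field L] [NumberField L] [IsCMField L]

/-! ## §1 ★ p863805's local integrability letter `hintLoc`, PAID for the (KW-fac) reading of the local factors -/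

section IntLoc

variable {N M : ℕ} (e : Fin N × Fin M ≃ Fin 2)
  (dV : Fin N → L) (hdV : ∀ i, IsCMField.complexConj L (dV i) = dV i)
  (dW : Fin M → L) (hdW : ∀ i, IsCMField.complexConj L (dW i) = dW i)
  (hdV0 : ∀ i, dV i ≠ 0) (hdW0 : ∀ i, dW i ≠ 0)

include hdV0 hdW0 in
/-- **§1 ★ p863805's `hintLoc` FOR THE (KW-fac) READING.**  For `χ` unitary, an Iwasawa datum `𝒦`, an abscissa `s₀`, a finite `S₀` off which `χ` is unramified (`hχS₀`), local
factors `b_{j,v}` whose flat twists `H_v^{2(s−s₀)}·b_{j,v}` lie in `I_v(s,χ_v)` above `S₀` (★ (KW-fac)'s `hb`), and Haar carriers `νv`: for EVERY index `S' ∈ M₂(L)`, every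
`h' ∈ H(𝔸)`, every finite place `v`, every `s` with `1 < re s` and every `j`, the local twisted factor
`y ↦ conj ψ_{S'}(ι_v y) · Fv_{j,v}(s)((w_Δ)_v · y · h'_v)`, `Fv_{j,v}(s) := if v ∈ S₀ then H^{2(s−s₀)}·b_{j,v} else Λ_{s,v}`, is `νv v`-integrable on `N_Δ(L⁺_v)` —
★ (iii-fin-int) `integrable_conj_unipDeltaChar_mul_of_isLocalSiegelSection` at a smooth local Siegel section (`hb` ∣ ★ `lambdaLoc_mem_localDegPS`).
[cite: KudlaSweet1997, §1] [cite: HarrisKudlaSweet1996, §1 (1.15)] [cite: Tan1999, §1 p. 166] -/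
theorem hintLoc_of_reading [DecidableEq (HeightOneSpectrum (𝓞 (Fp L)))]
    [∀ v : HeightOneSpectrum (𝓞 (Fp L)), MeasurableSpace ↥(unipDeltaLoc L e dV hdV dW hdW v)] [∀ v : HeightOneSpectrum (𝓞 (Fp L)), BorelSpace ↥(unipDeltaLoc L e dV hdV dW hdW v)]
    (νv : ∀ v : HeightOneSpectrum (𝓞 (Fp L)), Measure ↥(unipDeltaLoc L e dV hdV dW hdW v)) [∀ v, (νv v).IsHaarMeasure]
    {χ : HeckeCharacter L} (hχu : χ.IsUnitary) (𝒦 : IwasawaDatum L e dV hdV dW hdW) (s₀ : ℂ)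
    {S₀ : Finset (HeightOneSpectrum (𝓞 (Fp L)))} (hχS₀ : ∀ v, v ∉ S₀ → ∀ w : UnitaryGroup.PlacesOver L v, χ.IsUnramifiedAt w.1) {m : ℕ}
    (b : Fin m → (v : HeightOneSpectrum (𝓞 (Fp L))) → (UnitaryGroup.localPi L (IsCMField.complexConj L) (2 + 2) (hermD L e dV hdV dW hdW) v → ℂ))
    (hb : ∀ i, ∀ v ∈ S₀, ∀ s : ℂ, (fun u => ((modDelta L e dV hdV dW hdW (𝒦.pPart (locToAdelic L e dV hdV dW hdW v u)) : ℝ) : ℂ) ^ (2 * (s - s₀)) * b i v u) ∈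
      localDegPS (Fp L) L (IsCMField.complexConj L) (complexConj_imagUnit L) (imagUnit_ne_zero L) (imagUnit_mul_self L)
        v 2 (gramR_isSymm L e dV hdV dW hdW) (hermD_eq_map_gramD L e dV hdV dW hdW) (fun w => χ.localComponent w.1) s) :
    ∀ (S' : Matrix (Fin 2) (Fin 2) L) (h' : HA L e dV hdV dW hdW) (v : HeightOneSpectrum (𝓞 (Fp L))) (s : ℂ) (j : Fin m), 1 < s.re →
      Integrable (fun y : ↥(unipDeltaLoc L e dV hdV dW hdW v) =>
        conj (unipDeltaChar L e dV hdV dW hdW S'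
            (locToAdelic L e dV hdV dW hdW v (y : UnitaryGroup.localPi L (IsCMField.complexConj L) (2 + 2) (hermD L e dV hdV dW hdW) v)) : ℂ) *
          (fun (j : Fin m) (v : HeightOneSpectrum (𝓞 (Fp L))) (s : ℂ) (y : UnitaryGroup.localPi L (IsCMField.complexConj L) (2 + 2) (hermD L e dV hdV dW hdW) v) =>
              if v ∈ S₀ then ((modDelta L e dV hdV dW hdW (𝒦.pPart (locToAdelic L e dV hdV dW hdW v y)) : ℝ) : ℂ) ^ (2 * (s - s₀)) * b j v y
              else LambdaLoc L e dV hdV dW hdW v χ s y) j v s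
            (UnitaryGroup.evalPlace (Fp L) L (IsCMField.complexConj L) (2 + 2) (hermD L e dV hdV dW hdW) v
                (UnitaryGroup.finPart (Fp L) L (IsCMField.complexConj L) (2 + 2) (hermD L e dV hdV dW hdW) (weylDelta L e dV hdV dW hdW)) *
              (y : UnitaryGroup.localPi L (IsCMField.complexConj L) (2 + 2) (hermD L e dV hdV dW hdW) v) *
              UnitaryGroup.evalPlace (Fp L) L (IsCMField.complexConj L) (2 + 2) (hermD L e dV hdV dW hdW) v
                (UnitaryGroup.finPart (Fp L) L (IsCMField.complexConj L) (2 + 2) (hermD L e dV hdV dW hdW) h'))) (νv v) := by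
  intro S' h' v s j hs
  -- each local factor of the reading is a smooth local Siegel section of weight `(χ_v, s)`
  have hmem : (fun y : UnitaryGroup.localPi L (IsCMField.complexConj L) (2 + 2) (hermD L e dV hdV dW hdW) v =>
        if v ∈ S₀ then ((modDelta L e dV hdV dW hdW (𝒦.pPart (locToAdelic L e dV hdV dW hdW v y)) : ℝ) : ℂ) ^ (2 * (s - s₀)) * b j v y
        else LambdaLoc L e dV hdV dW hdW v χ s y) ∈
      localDegPS (Fp L) L (IsCMField.complexConj L) (complexConj_imagUnit L) (imagUnit_ne_zero L) (imagUnit_mul_self L)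
        v 2 (gramR_isSymm L e dV hdV dW hdW) (hermD_eq_map_gramD L e dV hdV dW hdW) (fun w => χ.localComponent w.1) s := by
    by_cases hv : v ∈ S₀
    · simp only [hv, if_true]
      exact hb j v hv s
    · simp only [hv, if_false]
      exact lambdaLoc_mem_localDegPS L e dV hdV dW hdW v χ s (hχS₀ v hv)
  exact integrable_conj_unipDeltaChar_mul_of_isLocalSiegelSection L e dV hdV dW hdW hdV0 hdW0 v (νv v) hχu hs hmem.1 hmem.2 S' _

end IntLoc

/-! ## §2 The K1-a♮ block of record at `n = 2` -/

open Classical in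
/-- **(K1a-OF-RECORD) THE K1-a♮ BLOCK OF RECORD AT `n = 2`.**  Socket prefix at `n = 2` VERBATIM (as ★ p863630, no `wq hwq`).  BY VALUE, in the tie's `obtain`ed currency:
(i) the bad set `T₀` of the Whittaker–Euler factorisation of record and the pole-cleared K1 scalar `G hG hsc` at `↑T₀` (★ p862613; BLOCK D reads the same `G` off `hwit`);
(ii) ★ p863805's outputs — local index sets `T`, shells `D`, moving exceptional set `Pm`, shell exponents `mτ`, raw archimedean ∕ local factors `A W` of the `m` pure tensors —
with the four spec letters this block reads: `hPT` (`Pm` misses `T₀`), `hq`, `hP` (the shell polynomials `Σ_{k≤mτ S v}(ε_v q_v^{1−2s})^k` are holomorphic on `{0 < re}`), and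
the SINGULAR TAIL OF RECORD `htail` on `{1 < re s}` with `c₀ = (∫β)⁻¹` (★ p863805 (c).2, (d), (e) BYTES); (iii) the letters still in flight — «ARCH-CONT» `Ac hAc hA`
(holomorphic continuation of the archimedean factors, agreeing with `A` on `{1 < re}`), «LOC-FACE» `Gn hGn hW` (`q_v`-rational regular continuation of the local factors),
the size `τa hτa`, the GROWTH letters near every `z ∈ {0 < re}` — (L2) `hAcb` Gaussian bound of `Ac`, (L3) `hGnb` polynomial bound of `∏_{v∈T} Gn`, (L4) the COUNT letter
`(16∕3)^{#Pm S h} ≤ Cp·H(h)^{ap}·(1+τa S)^{Np}`, (L5) `hPb` polynomial bound of the shells —, and the «LATTICE» letter `Tδ δ hδ k hterm` (per non-vanishing term and finite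
place `w` of `L`, an exponent controlled by the local height of `h`).
THEN ★ p863404 §2's conclusion VERBATIM at `n = 2` (`c S h := (∫β)⁻¹`, `I S h := univ`, `HT := Σ_j A·∏_{v∈T} W`, `P S h v s := Σ_{k≤mτ S v}(ε_v q_v^{1−2s})^k`, `T'' := ↑T₀`):
`∃ Eac` with the two WITNESS equations (explicit on rank-one `S`, `0` off rank one) and the twelve K1-a♮ letters `hEad hEac τa hτa Na hdeca Ca κa hCa hκa hsuppa` of ★ ED. 20
:133–:147.  Proof: ★ §2 with `hdec := ★ hdec_of_factorBounds` — (L0) the constant `‖((∫β)⁻¹ : ℂ)‖·H^0·(1+τ)^0`, (L1) `#univ = m`, (L4) ★ `hGb_of_countLetter hG` — and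
`hsupp := ★ hsupp_of_termPlaceSupport`.
[cite: KudlaRallis1994, §2 (2.10)–(2.12)] [cite: Tan1999, §3; §4 Prop. 4.8] [cite: KudlaSweet1997, §1] [cite: MoeglinWaldspurger1995, II.1.7, IV.1.9] [cite: Shimura1997, §18.4 Prop. 18.14] -/
theorem exists_kindOne_singularTerm_of_record
    (L : Type) [Field L] [NumberField L] [IsCMField L] (e : Fin 2 × Fin 1 ≃ Fin 2)
    (dV : Fin 2 → L) (hdV : ∀ i, IsCMField.complexConj L (dV i) = dV i) (hdV0 : ∀ i, dV i ≠ 0)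
    (dW : Fin 1 → L) (hdW : ∀ i, IsCMField.complexConj L (dW i) = dW i) (hdW0 : ∀ i, dW i ≠ 0)
    (lam : IdeleClassGroup L →ₜ* Circle) (hlam : IsConjugateSymplectic L lam) (hw : HasWeight L lam 1)
    (𝒦 : IwasawaDatum L e dV hdV dW hdW) (h𝒦 : 𝒦.IsStd) (f : ℂ → HA L e dV hdV dW hdW → ℂ)
    (hstd : IsStandardSectionFamily 𝒦 (toHeckeCharacter L lam⁻¹) f) (hcont : ∀ s, Continuous (f s))
    [MeasurableSpace (unipDelta L e dV hdV dW hdW)] [BorelSpace (unipDelta L e dV hdV dW hdW)]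
    (νN : Measure (unipDelta L e dV hdV dW hdW)) [νN.IsHaarMeasure]
    (β : unipDelta L e dV hdV dW hdW → ℝ≥0∞) (hβ : IsCoveringWeight (unipDeltaRat L e dV hdV dW hdW) β)
    (hβ0 : ∫⁻ u, β u ∂νN ≠ 0) (hβtop : ∫⁻ u, β u ∂νN ≠ ∞)
    {K : Set (unipDelta L e dV hdV dW hdW)} (hK : IsCompact K) (hβK : ∀ u, β u ≤ K.indicator 1 u)
    -- (i) the bad set of record and the pole-cleared K1 scalar of record at `↑T₀` (★ p862613 `exists_differentiableOn_sub_half_mul_scalarK1_cm`, obtained once in the tie)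
    (T₀ : Finset (HeightOneSpectrum (𝓞 (Fp L))))
    (G : ℂ → ℂ) (hG : DifferentiableOn ℂ G {s : ℂ | 0 < s.re})
    (hsc : ∀ s : ℂ, 1 / 2 < s.re →
      (s - 1 / 2) *
        (partialStandardL (T₀ : Set (HeightOneSpectrum (𝓞 (Fp L)))) (fun _ => {1}) (2 * s) /
          (partialStandardL (T₀ : Set (HeightOneSpectrum (𝓞 (Fp L)))) (fun _ => {1}) (2 * s + 1) *
            partialStandardL (T₀ : Set (HeightOneSpectrum (𝓞 (Fp L)))) (fun v => {(quadraticHeckeCharCM L).valueAtUniformizer v}) (2 * s + 2))) = G s)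
    -- (ii) ★ p863805's outputs of record (the tie's `obtain`ed names) with the four spec letters this block reads
    {m : ℕ}
    (T D Pm : skewMatrices ((IsCMField.complexConj L : L ≃ₐ[Fp L] L) : L →+* L) ((gramR L e dV hdV dW hdW).map (algebraMap (Fp L) L)) → HA L e dV hdV dW hdW →
      Finset (HeightOneSpectrum (𝓞 (Fp L))))
    (mτ : skewMatrices ((IsCMField.complexConj L : L ≃ₐ[Fp L] L) : L →+* L) ((gramR L e dV hdV dW hdW).map (algebraMap (Fp L) L)) → HeightOneSpectrum (𝓞 (Fp L)) → ℕ)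
    (A : skewMatrices ((IsCMField.complexConj L : L ≃ₐ[Fp L] L) : L →+* L) ((gramR L e dV hdV dW hdW).map (algebraMap (Fp L) L)) → Fin m → ℂ → HA L e dV hdV dW hdW → ℂ)
    (W : skewMatrices ((IsCMField.complexConj L : L ≃ₐ[Fp L] L) : L →+* L) ((gramR L e dV hdV dW hdW).map (algebraMap (Fp L) L)) → Fin m →
      HeightOneSpectrum (𝓞 (Fp L)) → ℂ → HA L e dV hdV dW hdW → ℂ)
    (hPT : ∀ S (h : HA L e dV hdV dW hdW), ∀ v ∈ Pm S h, v ∉ (T₀ : Set (HeightOneSpectrum (𝓞 (Fp L)))))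
    (hq : ∀ S (h : HA L e dV hdV dW hdW), ∀ v ∈ T S h, v.residueCard ≠ 0)
    (hP : ∀ S : skewMatrices ((IsCMField.complexConj L : L ≃ₐ[Fp L] L) : L →+* L) ((gramR L e dV hdV dW hdW).map (algebraMap (Fp L) L)),
      (S : Matrix (Fin 2) (Fin 2) L) ≠ 0 → (S : Matrix (Fin 2) (Fin 2) L).det = 0 → ∀ (h : HA L e dV hdV dW hdW), ∀ v ∈ D S h,
        DifferentiableOn ℂ (fun s : ℂ => ∑ k ∈ Finset.range (mτ S v + 1), ((quadraticHeckeCharCM L).valueAtUniformizer v * (v.residueCard : ℂ) ^ (1 - 2 * s)) ^ k)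
          {s : ℂ | 0 < s.re})
    (htail : ∀ S : skewMatrices ((IsCMField.complexConj L : L ≃ₐ[Fp L] L) : L →+* L) ((gramR L e dV hdV dW hdW).map (algebraMap (Fp L) L)),
      (S : Matrix (Fin 2) (Fin 2) L) ≠ 0 → (S : Matrix (Fin 2) (Fin 2) L).det = 0 → ∀ (s : ℂ) (h : HA L e dV hdV dW hdW), 1 < s.re →
        (((∫⁻ u, β u ∂νN).toReal⁻¹ : ℝ) : ℝ) • whittakerDelta L e dV hdV dW hdW νN (S : Matrix (Fin 2) (Fin 2) L) (f s) h =
          (((∫⁻ u, β u ∂νN).toReal⁻¹ : ℝ) : ℂ) * (∑ j, A S j s h * ∏ v ∈ T S h, W S j v s h) *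
            (partialStandardL ((T₀ : Set (HeightOneSpectrum (𝓞 (Fp L)))) ∪ (Pm S h : Set (HeightOneSpectrum (𝓞 (Fp L))))) (fun _ => {1}) (2 * s) /
              (partialStandardL ((T₀ : Set (HeightOneSpectrum (𝓞 (Fp L)))) ∪ (Pm S h : Set (HeightOneSpectrum (𝓞 (Fp L))))) (fun _ => {1}) (2 * s + 1) *
                partialStandardL ((T₀ : Set (HeightOneSpectrum (𝓞 (Fp L)))) ∪ (Pm S h : Set (HeightOneSpectrum (𝓞 (Fp L)))))
                  (fun v => {(quadraticHeckeCharCM L).valueAtUniformizer v}) (2 * s + 2))) *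
            ∏ v ∈ D S h, ∑ k ∈ Finset.range (mτ S v + 1), ((quadraticHeckeCharCM L).valueAtUniformizer v * (v.residueCard : ℂ) ^ (1 - 2 * s)) ^ k)
    -- (iii) THE LETTERS IN FLIGHT.  «ARCH-CONT»: the archimedean factors continue holomorphically to `{0 < re}` ((Φ-S1) R90-C131-p02)
    (Ac : skewMatrices ((IsCMField.complexConj L : L ≃ₐ[Fp L] L) : L →+* L) ((gramR L e dV hdV dW hdW).map (algebraMap (Fp L) L)) → Fin m → ℂ → HA L e dV hdV dW hdW → ℂ)
    (hAc : ∀ S : skewMatrices ((IsCMField.complexConj L : L ≃ₐ[Fp L] L) : L →+* L) ((gramR L e dV hdV dW hdW).map (algebraMap (Fp L) L)),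
      (S : Matrix (Fin 2) (Fin 2) L) ≠ 0 → (S : Matrix (Fin 2) (Fin 2) L).det = 0 → ∀ (h : HA L e dV hdV dW hdW) (i : Fin m),
        DifferentiableOn ℂ (fun s => Ac S i s h) {s : ℂ | 0 < s.re})
    (hA : ∀ S : skewMatrices ((IsCMField.complexConj L : L ≃ₐ[Fp L] L) : L →+* L) ((gramR L e dV hdV dW hdW).map (algebraMap (Fp L) L)),
      (S : Matrix (Fin 2) (Fin 2) L) ≠ 0 → (S : Matrix (Fin 2) (Fin 2) L).det = 0 → ∀ (h : HA L e dV hdV dW hdW) (i : Fin m) (s : ℂ), 1 < s.re → A S i s h = Ac S i s h)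
    -- «LOC-FACE»: the local factors continue to `q_v`-rational functions regular at every `s₀ ∈ {0 < re}` (LH4-p07 over ★ `exists_localFace_kindOneSingular`)
    (Gn : skewMatrices ((IsCMField.complexConj L : L ≃ₐ[Fp L] L) : L →+* L) ((gramR L e dV hdV dW hdW).map (algebraMap (Fp L) L)) → Fin m →
      HeightOneSpectrum (𝓞 (Fp L)) → ℂ → HA L e dV hdV dW hdW → ℂ)
    (hGn : ∀ S : skewMatrices ((IsCMField.complexConj L : L ≃ₐ[Fp L] L) : L →+* L) ((gramR L e dV hdV dW hdW).map (algebraMap (Fp L) L)),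
      (S : Matrix (Fin 2) (Fin 2) L) ≠ 0 → (S : Matrix (Fin 2) (Fin 2) L).det = 0 → ∀ (h : HA L e dV hdV dW hdW) (i : Fin m), ∀ v ∈ T S h,
        ∀ s₀ : ℂ, 0 < s₀.re → IsQRationalRegularAt (v.residueCard) s₀ (fun s => Gn S i v s h))
    (hW : ∀ S : skewMatrices ((IsCMField.complexConj L : L ≃ₐ[Fp L] L) : L →+* L) ((gramR L e dV hdV dW hdW).map (algebraMap (Fp L) L)),
      (S : Matrix (Fin 2) (Fin 2) L) ≠ 0 → (S : Matrix (Fin 2) (Fin 2) L).det = 0 → ∀ (h : HA L e dV hdV dW hdW) (i : Fin m), ∀ v ∈ T S h,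
        ∀ s : ℂ, 1 < s.re → W S i v s h = Gn S i v s h)
    -- the size, and the GROWTH letters near every `z ∈ {0 < re}`: (L2) Gaussian decay of `Ac` (C131-p02 `hAcb_of_corner`), (L3) the finite head, (L4) the COUNT letter of the
    -- moving set (★ p864035's input), (L5) the shells
    (τa : skewMatrices ((IsCMField.complexConj L : L ≃ₐ[Fp L] L) : L →+* L) ((gramR L e dV hdV dW hdW).map (algebraMap (Fp L) L)) → ℝ)
    (hτa : ∀ S : skewMatrices ((IsCMField.complexConj L : L ≃ₐ[Fp L] L) : L →+* L) ((gramR L e dV hdV dW hdW).map (algebraMap (Fp L) L)),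
      ‖(fun i j => NumberField.mixedEmbedding L ((S : Matrix (Fin 2) (Fin 2) L) i j))‖ ≤ τa S)
    (hAcb : ∀ z : ℂ, 0 < z.re → ∃ (N₁ : ℕ) (C a b a' r : ℝ), 0 ≤ C ∧ 0 ≤ a ∧ 0 < b ∧ 0 ≤ a' ∧ 0 < r ∧
      ∀ (S : skewMatrices ((IsCMField.complexConj L : L ≃ₐ[Fp L] L) : L →+* L) ((gramR L e dV hdV dW hdW).map (algebraMap (Fp L) L))) (s : ℂ), dist s z < r →
      ∀ h : HA L e dV hdV dW hdW, (S : Matrix (Fin 2) (Fin 2) L) ≠ 0 → (S : Matrix (Fin 2) (Fin 2) L).det = 0 → ∀ i : Fin m,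
      ‖Ac S i s h‖ ≤ C * adelicHeightGL (2 + 2) L (h : GL (Fin (2 + 2)) (AdeleRing (𝓞 L) L)) ^ a *
        (Real.exp (-(b * adelicHeightGL (2 + 2) L (h : GL (Fin (2 + 2)) (AdeleRing (𝓞 L) L)) ^ (-a') * τa S)) * (1 + τa S) ^ N₁))
    (hGnb : ∀ z : ℂ, 0 < z.re → ∃ (N₂ : ℕ) (C a r : ℝ), 0 ≤ C ∧ 0 ≤ a ∧ 0 < r ∧
      ∀ (S : skewMatrices ((IsCMField.complexConj L : L ≃ₐ[Fp L] L) : L →+* L) ((gramR L e dV hdV dW hdW).map (algebraMap (Fp L) L))) (s : ℂ), dist s z < r →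
      ∀ h : HA L e dV hdV dW hdW, (S : Matrix (Fin 2) (Fin 2) L) ≠ 0 → (S : Matrix (Fin 2) (Fin 2) L).det = 0 → ∀ i : Fin m,
      ‖∏ v ∈ T S h, Gn S i v s h‖ ≤ C * adelicHeightGL (2 + 2) L (h : GL (Fin (2 + 2)) (AdeleRing (𝓞 L) L)) ^ a * (1 + τa S) ^ N₂)
    (Np : ℕ) {Cp ap : ℝ} (hCp : 0 ≤ Cp) (hap : 0 ≤ ap)
    (hPm : ∀ (S : skewMatrices ((IsCMField.complexConj L : L ≃ₐ[Fp L] L) : L →+* L) ((gramR L e dV hdV dW hdW).map (algebraMap (Fp L) L))) (h : HA L e dV hdV dW hdW),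
      (S : Matrix (Fin 2) (Fin 2) L) ≠ 0 → (S : Matrix (Fin 2) (Fin 2) L).det = 0 →
      (16 / 3 : ℝ) ^ (Pm S h).card ≤ Cp * adelicHeightGL (2 + 2) L (h : GL (Fin (2 + 2)) (AdeleRing (𝓞 L) L)) ^ ap * (1 + τa S) ^ Np)
    (hPb : ∀ z : ℂ, 0 < z.re → ∃ (N₄ : ℕ) (C a r : ℝ), 0 ≤ C ∧ 0 ≤ a ∧ 0 < r ∧
      ∀ (S : skewMatrices ((IsCMField.complexConj L : L ≃ₐ[Fp L] L) : L →+* L) ((gramR L e dV hdV dW hdW).map (algebraMap (Fp L) L))) (s : ℂ), dist s z < r →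
      ∀ h : HA L e dV hdV dW hdW, (S : Matrix (Fin 2) (Fin 2) L) ≠ 0 → (S : Matrix (Fin 2) (Fin 2) L).det = 0 →
      ‖∏ v ∈ D S h, ∑ k ∈ Finset.range (mτ S v + 1), ((quadraticHeckeCharCM L).valueAtUniformizer v * (v.residueCard : ℂ) ^ (1 - 2 * s)) ^ k‖ ≤
        C * adelicHeightGL (2 + 2) L (h : GL (Fin (2 + 2)) (AdeleRing (𝓞 L) L)) ^ a * (1 + τa S) ^ N₄)
    -- «LATTICE»: the per-term, per-place lattice letter (K2Liu-p14 (K1a-supp) ED. 2)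
    (Tδ : Finset (HeightOneSpectrum (𝓞 L))) (δ : HeightOneSpectrum (𝓞 L) → ℕ) (hδ : ∀ w ∉ Tδ, δ w = 0) (k : ℕ)
    (hterm : ∀ (S : skewMatrices ((IsCMField.complexConj L : L ≃ₐ[Fp L] L) : L →+* L) ((gramR L e dV hdV dW hdW).map (algebraMap (Fp L) L))),
      (S : Matrix (Fin 2) (Fin 2) L) ≠ 0 → (S : Matrix (Fin 2) (Fin 2) L).det = 0 → ∀ (s : ℂ) (h : HA L e dV hdV dW hdW), ((2 : ℕ) : ℝ) / 2 < s.re →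
      ∀ i : Fin m, Ac S i s h ≠ 0 → (∀ v ∈ T S h, Gn S i v s h ≠ 0) →
      ∀ w : HeightOneSpectrum (𝓞 L), ∃ mw : ℕ,
        ((Ideal.absNorm w.asIdeal : ℕ) : ℝ) ^ mw ≤ ((Ideal.absNorm w.asIdeal : ℕ) : ℝ) ^ δ w * (GLn.localHeight (2 + 2) L w (h : GL (Fin (2 + 2)) (AdeleRing (𝓞 L) L)) : ℝ) ^ k ∧
          ∀ a b, Valued.v ((((S : Matrix (Fin 2) (Fin 2) L) a b : L)) : w.adicCompletion L) ≤ WithZero.exp (mw : ℤ)) :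
    ∃ (Eac : skewMatrices ((IsCMField.complexConj L : L ≃ₐ[Fp L] L) : L →+* L) ((gramR L e dV hdV dW hdW).map (algebraMap (Fp L) L)) → ℂ → HA L e dV hdV dW hdW → ℂ),
      -- the WITNESS equations ((F-V) transparency; BLOCK D's row D-1 reads `hwit`)
      (∀ (S : skewMatrices ((IsCMField.complexConj L : L ≃ₐ[Fp L] L) : L →+* L) ((gramR L e dV hdV dW hdW).map (algebraMap (Fp L) L))) (s : ℂ) (h : HA L e dV hdV dW hdW),
        (S : Matrix (Fin 2) (Fin 2) L) ≠ 0 → (S : Matrix (Fin 2) (Fin 2) L).det = 0 →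
          Eac S s h = (((∫⁻ u, β u ∂νN).toReal⁻¹ : ℝ) : ℂ) * (∑ i, Ac S i s h * ∏ v ∈ T S h, Gn S i v s h) *
            ((∏ v ∈ Pm S h, ((1 - (v.residueCard : ℂ) ^ (-(2 * s))) / ((1 - (v.residueCard : ℂ) ^ (-(2 * s + 1))) * (1 - (quadraticHeckeCharCM L).valueAtUniformizer v * (v.residueCard : ℂ) ^ (-(2 * s + 2)))))) * G s) *
            ∏ v ∈ D S h, ∑ k ∈ Finset.range (mτ S v + 1), ((quadraticHeckeCharCM L).valueAtUniformizer v * (v.residueCard : ℂ) ^ (1 - 2 * s)) ^ k) ∧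
      (∀ (S : skewMatrices ((IsCMField.complexConj L : L ≃ₐ[Fp L] L) : L →+* L) ((gramR L e dV hdV dW hdW).map (algebraMap (Fp L) L))) (s : ℂ) (h : HA L e dV hdV dW hdW),
        ¬ ((S : Matrix (Fin 2) (Fin 2) L) ≠ 0 ∧ (S : Matrix (Fin 2) (Fin 2) L).det = 0) → Eac S s h = 0) ∧
      -- the twelve K1-a♮ letters of ★ ED. 20 :133–:147, token for token at `n = 2`
      (∀ S x, DifferentiableOn ℂ (fun s => Eac S s x) {s : ℂ | 0 < s.re}) ∧
      (∀ S : skewMatrices ((IsCMField.complexConj L : L ≃ₐ[Fp L] L) : L →+* L) ((gramR L e dV hdV dW hdW).map (algebraMap (Fp L) L)),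
        (S : Matrix (Fin 2) (Fin 2) L) ≠ 0 → (S : Matrix (Fin 2) (Fin 2) L).det = 0 → ∀ (s : ℂ) (h : HA L e dV hdV dW hdW), ((2 : ℕ) : ℝ) / 2 < s.re →
          (s - 1 / 2) * (((∫⁻ u, β u ∂νN).toReal⁻¹ : ℝ) • whittakerDelta L e dV hdV dW hdW νN (S : Matrix (Fin 2) (Fin 2) L) (f s) h) = Eac S s h) ∧
      ∃ (τa : skewMatrices ((IsCMField.complexConj L : L ≃ₐ[Fp L] L) : L →+* L) ((gramR L e dV hdV dW hdW).map (algebraMap (Fp L) L)) → ℝ),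
        (∀ S : skewMatrices ((IsCMField.complexConj L : L ≃ₐ[Fp L] L) : L →+* L) ((gramR L e dV hdV dW hdW).map (algebraMap (Fp L) L)),
          ‖(fun i j => NumberField.mixedEmbedding L ((S : Matrix (Fin 2) (Fin 2) L) i j))‖ ≤ τa S) ∧
        ∃ Na : ℕ,
          (∀ z : ℂ, 0 < z.re → ∃ C a c a' r : ℝ, 0 ≤ C ∧ 0 ≤ a ∧ 0 < c ∧ 0 ≤ a' ∧ 0 < r ∧ ∀ S (s : ℂ), dist s z < r → ∀ h : HA L e dV hdV dW hdW,
            ‖Eac S s h‖ ≤ C * adelicHeightGL (2 + 2) L (h : GL (Fin (2 + 2)) (AdeleRing (𝓞 L) L)) ^ a *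
              (Real.exp (-(c * adelicHeightGL (2 + 2) L (h : GL (Fin (2 + 2)) (AdeleRing (𝓞 L) L)) ^ (-a') * τa S)) * (1 + τa S) ^ Na)) ∧
          ∃ Ca κa : ℝ, 0 < Ca ∧ 0 ≤ κa ∧
            (∀ S (s : ℂ) (h : HA L e dV hdV dW hdW), 0 < s.re → Eac S s h ≠ 0 →
              ∃ D : ℕ, 1 ≤ D ∧ (D : ℝ) ≤ Ca * adelicHeightGL (2 + 2) L (h : GL (Fin (2 + 2)) (AdeleRing (𝓞 L) L)) ^ κa ∧
                ∀ i j, IsIntegral ℤ ((D : L) * (S : Matrix (Fin 2) (Fin 2) L) i j)) := by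
  -- (L0) the constant `c S h := (∫β)⁻¹`: `‖(c₀ : ℂ)‖ ≤ ‖(c₀ : ℂ)‖ · H^0 · (1 + τa S)^0`
  have hcb : ∀ (S : skewMatrices ((IsCMField.complexConj L : L ≃ₐ[Fp L] L) : L →+* L) ((gramR L e dV hdV dW hdW).map (algebraMap (Fp L) L))) (h : HA L e dV hdV dW hdW),
      (S : Matrix (Fin 2) (Fin 2) L) ≠ 0 → (S : Matrix (Fin 2) (Fin 2) L).det = 0 →
      ‖(fun (_ : skewMatrices ((IsCMField.complexConj L : L ≃ₐ[Fp L] L) : L →+* L) ((gramR L e dV hdV dW hdW).map (algebraMap (Fp L) L))) (_ : HA L e dV hdV dW hdW) =>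
          ((((∫⁻ u, β u ∂νN).toReal⁻¹ : ℝ) : ℂ))) S h‖ ≤
        ‖((((∫⁻ u, β u ∂νN).toReal⁻¹ : ℝ) : ℂ))‖ * adelicHeightGL (2 + 2) L (h : GL (Fin (2 + 2)) (AdeleRing (𝓞 L) L)) ^ (0 : ℝ) * (1 + τa S) ^ 0 := by
    intro S h _ _
    rw [Real.rpow_zero, pow_zero, mul_one, mul_one]
  -- (L1) the tensor count `#univ = m`
  have hI : ∀ (S : skewMatrices ((IsCMField.complexConj L : L ≃ₐ[Fp L] L) : L →+* L) ((gramR L e dV hdV dW hdW).map (algebraMap (Fp L) L))) (h : HA L e dV hdV dW hdW),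
      ((fun (_ : skewMatrices ((IsCMField.complexConj L : L ≃ₐ[Fp L] L) : L →+* L) ((gramR L e dV hdV dW hdW).map (algebraMap (Fp L) L))) (_ : HA L e dV hdV dW hdW) =>
        (Finset.univ : Finset (Fin m))) S h).card ≤ m := fun _ _ => by
    simp only [Finset.card_univ, Fintype.card_fin, le_refl]
  -- (L4) ★ p864035 from the count letter and the continuity of `G`
  have hGb := hGb_of_countLetter L e dV hdV dW hdW G hG Pm τa Np hCp hap hPm
  -- (dec) ★ p863488
  obtain ⟨Na, hdec⟩ := hdec_of_factorBounds L e dV hdV dW hdW G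
    (fun _ _ => ((((∫⁻ u, β u ∂νN).toReal⁻¹ : ℝ) : ℂ))) D
    (fun S _ v s => ∑ k ∈ Finset.range (mτ S v + 1), ((quadraticHeckeCharCM L).valueAtUniformizer v * (v.residueCard : ℂ) ^ (1 - 2 * s)) ^ k)
    Pm (fun _ _ => (Finset.univ : Finset (Fin m))) T Ac Gn τa hτa 0 (norm_nonneg _) le_rfl hcb m hI
    (fun z hz => by
      obtain ⟨N₁, C, a, b, a', r, hC, ha, hb, ha', hr, hbd⟩ := hAcb z hz
      exact ⟨N₁, C, a, b, a', r, hC, ha, hb, ha', hr, fun S s hs h hS0 hSd i _ => hbd S s hs h hS0 hSd i⟩)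
    (fun z hz => by
      obtain ⟨N₂, C, a, r, hC, ha, hr, hbd⟩ := hGnb z hz
      exact ⟨N₂, C, a, r, hC, ha, hr, fun S s hs h hS0 hSd i _ => hbd S s hs h hS0 hSd i⟩)
    hGb hPb
  -- (supp½) ★ p863740
  obtain ⟨Ca, κa, hCa, hκa, hsupp⟩ := hsupp_of_termPlaceSupport L e dV hdV dW hdW
    (fun _ _ => ((((∫⁻ u, β u ∂νN).toReal⁻¹ : ℝ) : ℂ))) (fun _ _ => (Finset.univ : Finset (Fin m))) T Ac Gn Pm G D
    (fun S _ v s => ∑ k ∈ Finset.range (mτ S v + 1), ((quadraticHeckeCharCM L).valueAtUniformizer v * (v.residueCard : ℂ) ^ (1 - 2 * s)) ^ k)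
    Tδ δ hδ k (fun S hS0 hSd s h hs i _ hAi hGi => hterm S hS0 hSd s h hs i hAi hGi)
  -- ★ p863404 §2 at the letters of record
  exact exists_kindOne_singularTermPackage_of_placeLetters L e dV hdV hdV0 dW hdW hdW0 lam hlam hw 𝒦 h𝒦 f hstd hcont νN β hβ hβ0 hβtop hK hβK
    (T₀ : Set (HeightOneSpectrum (𝓞 (Fp L)))) G hG hsc
    (fun _ _ => ((((∫⁻ u, β u ∂νN).toReal⁻¹ : ℝ) : ℂ))) D
    (fun S _ v s => ∑ k ∈ Finset.range (mτ S v + 1), ((quadraticHeckeCharCM L).valueAtUniformizer v * (v.residueCard : ℂ) ^ (1 - 2 * s)) ^ k)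
    hP Pm hPT (fun S s h => ∑ j, A S j s h * ∏ v ∈ T S h, W S j v s h) htail
    (fun _ _ => (Finset.univ : Finset (Fin m))) T (fun v => v.residueCard) hq A W (fun _ _ _ _ _ _ => rfl)
    Ac (fun S hS0 hSd h i _ => hAc S hS0 hSd h i) (fun S hS0 hSd h i _ s hs => hA S hS0 hSd h i s hs)
    Gn (fun S hS0 hSd h i _ v hv s₀ hs₀ => hGn S hS0 hSd h i v hv s₀ hs₀) (fun S hS0 hSd h i _ v hv s hs => hW S hS0 hSd h i v hv s hs)
    τa hτa Na hdec hCa hκa hsupp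

end Summit.HodgeConjecture.HodgeConjecture.Cruxes.HLiu418.K2LiuKindOneSingularTermOfRecord

end
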